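import Summits.KontsevichZagierPeriods.KontsevichZagierPeriods.Theorems.LinRedNormalFormArrangementNormalFormSeparateThreeHHKSecPrep
import Summits.KontsevichZagierPeriods.KontsevichZagierPeriods.Theorems.LinRedNormalFormArrangementNormalFormSeparateThreeHHKSectorB

/-!
# The sector theorem of type (I): graded in `t`, free in `v, u`

(Line `janus-bands`, crux `ArrangementNormalForm`, stub `stub_separateHigh`, part `HHKSecI` of
the wall-invariant termwise-split lemma `separateThree_hHk` in base dimension `3` with fibres.)
At a base point `z₁` with the numerator in graded form `F(z₁ + ξ) = Fnum l₁ l₂ c ξ` and Taylor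
pieces `Fpc l₁ l₂ c i` (part `HHKTaylor`), consider a nested thin sector with frame `d, Q, S`
along which the common denominator is `t^{Dt}` times a regular factor `ω` (no power of `v` or
`u`: the direction `d` lies on no wall through `z₁`; parts `HHKSectorB`, `HHKSector`). Then the
density `g = 𝟙_Y (∑ |Ri i|) m` has finite integral over the sector for all small scales
(`sector_typeI`, registered as `separateThreeHHK_secI`). Proof: inside/outside dichotomy
(`SepHHK.eventually_in_or_out3`); inside, the weight `wt3 Dt 0 0 |ω| (m ∘ npt)` is almost
decreasing towards the corner with logarithmic costs in `v, u` (parts `HHKWeight`); the rows of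
`F` along the sector are `Fnum (crow c a) ∘ evec`, the lowest non-zero one is bounded below on
dyadic boxes (`SepHHK.PP_ne_zero`, `SepHHK.lower_dyadic₂`), so the ray theorem
`SepHHK.ray_order3` integrates `t^{a₀}`, which dominates every piece (`abs_Fpc_smul_le`).
-/

noncomputable section

open Set MeasureTheory Filter Topology
open scoped ENNReal

namespace Summit.KontsevichZagierPeriods.ArrangementNormalForm.JanusBands

namespace SepHHK

open SepTwo

/-- The weight without explicit powers of `v, u`. -/
theorem wt3_zero_zero (Dt : ℕ) (ωa : ℝ → ℝ → ℝ → ℝ) (Λ' : ℝ → ℝ → ℝ → ℝ≥0∞) (t v u : ℝ) :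
    wt3 Dt 0 0 ωa Λ' t v u = ENNReal.ofReal (t ^ 2 * v / (t ^ Dt * ωa t v u)) * Λ' t v u := by
  simp [wt3, phi3]

/-- Bounds for the rows of the pieces on the unit square of chart directions. -/
theorem exists_rows_bound {D : ℕ} (l₁ l₂ : ℝ) (c : Coef₃ D) (d Q S : Fin 3 → ℝ) :
    ∃ B : ℝ, 0 ≤ B ∧ ∀ (a' : Fin (3 * D + 1)) (i : Fin (D + 1)), ∀ v ∈ Icc (0 : ℝ) 1,
      ∀ u ∈ Icc (0 : ℝ) 1, |Fpc l₁ l₂ (crow c a') i (evec d Q S v u)| ≤ B := by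
  obtain ⟨B, hB0, hB⟩ := exists_bound_unit_square
    (fun y => ∑ a' : Fin (3 * D + 1), ∑ i : Fin (D + 1), |Fpc l₁ l₂ (crow c a') i y|)
    (continuous_finsetSum _ fun a' _ => continuous_finsetSum _ fun i _ =>
      (continuous_Fpc l₁ l₂ (crow c a') i).abs) d Q S
  refine ⟨B, hB0, fun a' i v hv u hu => ?_⟩
  have h := hB v hv u hu
  rw [abs_of_nonneg (Finset.sum_nonneg fun _ _ => Finset.sum_nonneg fun _ _ => abs_nonneg _)] at h
  refine le_trans ?_ h
  refine le_trans ?_ (Finset.single_le_sum (f := fun a'' : Fin (3 * D + 1) => ∑ i : Fin (D + 1),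
    |Fpc l₁ l₂ (crow c a'') i (evec d Q S v u)|)
    (fun _ _ => Finset.sum_nonneg fun _ _ => abs_nonneg _) (Finset.mem_univ a'))
  exact Finset.single_le_sum (f := fun i' : Fin (D + 1) => |Fpc l₁ l₂ (crow c a') i' (evec d Q S v u)|)
    (fun _ _ => abs_nonneg _) (Finset.mem_univ i)

/-- **The sector theorem of type (I).** See the module docstring. -/
theorem sector_typeI {k mL m'' : ℕ} (φ : Fin m'' → (Fin 3 → ℝ) × ℝ)
    (lo hi : Fin k → Fin k ⊕ Atm 3) (a : Fin k → Option (Atm 3))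
    (κ : Fin mL → Fin 2 → ℝ) (μ : Fin mL → ℝ) (e : Fin mL → ℕ) (n : ℕ) (l₁ l₂ l₀ : ℝ)
    (N : ℕ) (q : ℕ → MvPolynomial (Fin 2) ℝ) (R : (Fin 3 → ℝ) → ℝ) (Ri : ℕ → (Fin 3 → ℝ) → ℝ)
    (z₁ : Fin 3 → ℝ)
    (hR : ∀ x, R x = (∑ i ∈ Finset.range N, MvPolynomial.eval (pr2 x) (q i) * lam3 l₁ l₂ l₀ x ^ i) /
      common κ μ e n l₁ l₂ l₀ x)
    (hRi : ∀ i < N, ∀ x, Ri i x = MvPolynomial.eval (pr2 x) (q i) * lam3 l₁ l₂ l₀ x ^ i /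
      common κ μ e n l₁ l₂ l₀ x)
    (hRm : Measurable R) (hRim : ∀ i, Measurable (Ri i))
    (hfinY : ∫⁻ x in {x | ∀ j, 0 < rav x (φ j)}, ENNReal.ofReal |R x| * lmass lo hi a (av x) < ∞)
    {D : ℕ} (hND : N ≤ D + 1) (c : Coef₃ D) (hc : c ≠ 0)
    (hF : ∀ ξ : Fin 3 → ℝ, (∑ i ∈ Finset.range N, MvPolynomial.eval (pr2 (z₁ + ξ)) (q i) *
      lam3 l₁ l₂ l₀ (z₁ + ξ) ^ i) = Fnum l₁ l₂ c ξ)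
    (hFi : ∀ (i : ℕ) (hi : i < N) (ξ : Fin 3 → ℝ), MvPolynomial.eval (pr2 (z₁ + ξ)) (q i) *
      lam3 l₁ l₂ l₀ (z₁ + ξ) ^ i = Fpc l₁ l₂ c ⟨i, lt_of_lt_of_le hi hND⟩ ξ)
    (d Q S : Fin 3 → ℝ) (hdet : det3 d Q S ≠ 0) (Dt : ℕ) (ω : ℝ → ℝ → ℝ → ℝ)
    (hωm : Measurable fun p : ℝ × ℝ × ℝ => ω p.1 p.2.1 p.2.2)
    (hcommon : ∀ t v u : ℝ, 0 ≤ t → 0 ≤ v → 0 ≤ u →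
      |common κ μ e n l₁ l₂ l₀ (npt z₁ d Q S t v u)| = t ^ Dt * |ω t v u|)
    {ωlo ωhi ρ : ℝ} (hωlo : 0 < ωlo) (hρ : 0 < ρ)
    (hωb : ∀ t v u : ℝ, |t| < ρ → |v| < ρ → |u| < ρ → ωlo ≤ |ω t v u| ∧ |ω t v u| ≤ ωhi) :
    ∀ᶠ δt in 𝓝[>] (0 : ℝ), ∀ᶠ δ in 𝓝[>] (0 : ℝ), ∀ᶠ ε in 𝓝[>] (0 : ℝ),
      ∫⁻ z in nsector z₁ d Q S δt δ (Ico 0 ε), {x : Fin 3 → ℝ | ∀ j, 0 < rav x (φ j)}.indicator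
        (fun x => (∑ i ∈ Finset.range N, ENNReal.ofReal |Ri i x|) * lmass lo hi a (av x)) z < ∞ := by
  set Y : Set (Fin 3 → ℝ) := {x | ∀ j, 0 < rav x (φ j)} with hY
  have hYm : MeasurableSet Y := measurableSet_Y3 φ
  set mm : (Fin 3 → ℝ) → ℝ≥0∞ := fun x => lmass lo hi a (av x) with hmm
  have hm : Measurable mm := measurable_lmass_av lo hi a
  -- weight data
  obtain ⟨δ₀, hδ₀, ε₀, hε₀, η₀, hη₀, KΛ, hKΛ, Kn, CΛ, hCΛ, hΛmono, -, hΛv, hΛu⟩ :=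
    weight_hyps3 lo hi a z₁ d Q S
  -- order and lower-bound data
  obtain ⟨a₀, ha₀, hcrow, hlow⟩ := exists_order3 c hc
  have hPP : PP l₁ l₂ (crow c a₀) d Q S ≠ 0 := PP_ne_zero l₁ l₂ (crow c a₀) hdet a₀
    (fun r ξ => Fnum_crow_smul l₁ l₂ c a₀ ξ r) (Fnum_ne_zero_of_coef l₁ l₂ (crow c a₀) hcrow)
  obtain ⟨v₁, hv₁, -, hdy⟩ := lower_dyadic₂ (PP l₁ l₂ (crow c a₀) d Q S) hPP
  obtain ⟨B, hB0, hB⟩ := exists_rows_bound l₁ l₂ c d Q S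
  -- sign dichotomy and scales
  have hsign := eventually_in_or_out3 φ z₁ d Q S
  have hcδt : 0 < min (min (δ₀ / 4) (ρ / 4)) 1 := by positivity
  filter_upwards [hsign, Ioo_mem_nhdsGT hcδt] with δt hsδt hδt
  have hδtpos : 0 < δt := hδt.1
  obtain ⟨hδta, hδt1⟩ := lt_min_iff.1 hδt.2
  obtain ⟨hδt0, hδtρ⟩ := lt_min_iff.1 hδta
  have h4δt : 4 * δt ≤ δ₀ := by linarith
  have hδtδ₀ : δt ≤ δ₀ := by linarith
  have hcδ : 0 < min (min (ε₀ / 16) (ρ / 16)) (min (v₁ / 4) (1 / 4)) := by positivity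
  filter_upwards [hsδt, Ioo_mem_nhdsGT hcδ] with δ hsδ hδ
  have hδpos : 0 < δ := hδ.1
  obtain ⟨hδa, hδb⟩ := lt_min_iff.1 hδ.2
  obtain ⟨hδ0, hδρ⟩ := lt_min_iff.1 hδa
  obtain ⟨hδv, hδ1⟩ := lt_min_iff.1 hδb
  have h4δ : 4 * δ ≤ ε₀ := by linarith
  obtain ⟨η₁, hη₁, hη₁1, hdyη⟩ := hdy δ hδ.1 (by linarith)
  have hcε : 0 < min (min (η₀ / 16) (ρ / 16)) (η₁ / 4) := by positivity
  filter_upwards [hsδ, Ioo_mem_nhdsGT hcε] with ε hsε hε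
  have hεpos : 0 < ε := hε.1
  obtain ⟨hεa, hεη⟩ := lt_min_iff.1 hε.2
  obtain ⟨hε0, hερ⟩ := lt_min_iff.1 hεa
  have h4ε : 4 * ε ≤ η₀ := by linarith
  have hε1 : ε ≤ 1 / 4 := by linarith
  obtain ⟨h, hh, hle⟩ := hdyη ε hε.1 (by linarith)
  -- outside: no mass
  rcases hsε with hin4 | hout
  swap
  · rw [nsector_zero N z₁ d Q S hYm hm hRim hdet fun t ht v hv u hu =>
      hout t (Ioo_four hδt.1 ht) v (Ioo_four hδ.1 hv) u (Ioo_four hε.1 hu)]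
    exact ENNReal.zero_lt_top
  have hin : ∀ t ∈ Ioo (0 : ℝ) δt, ∀ v ∈ Ioo (0 : ℝ) δ, ∀ u ∈ Ioo (0 : ℝ) ε,
      npt z₁ d Q S t v u ∈ Y := fun t ht v hv u hu =>
    hin4 t (Ioo_four hδt.1 ht) v (Ioo_four hδ.1 hv) u (Ioo_four hε.1 hu)
  refine nsector_finite N z₁ d Q S hYm hm hRim hdet hin ?_
  -- the weight
  set ωa : ℝ → ℝ → ℝ → ℝ := fun t v u => |ω t v u| with hωa
  set Λ' : ℝ → ℝ → ℝ → ℝ≥0∞ := fun t v u => mm (npt z₁ d Q S t v u) with hΛ'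
  set W : ℝ → ℝ → ℝ → ℝ≥0∞ := wt3 Dt 0 0 ωa Λ' with hW
  have hωam : Measurable fun p : ℝ × ℝ × ℝ => ωa p.1 p.2.1 p.2.2 := hωm.abs
  have hWm : Measurable fun p : ℝ × ℝ × ℝ => W p.1 p.2.1 p.2.2 :=
    measurable_wt3 Dt 0 0 hωam (measurable_lmass_npt lo hi a z₁ d Q S)
  -- bounds of the regular factor on the `16`-box and the `4`-box
  have hωB : ∀ t ∈ Ioo (0 : ℝ) (4 * δt), ∀ v ∈ Ioo (0 : ℝ) (4 * (4 * δ)), ∀ u ∈ Ioo (0 : ℝ) (4 * (4 * ε)),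
      ωlo ≤ ωa t v u ∧ ωa t v u ≤ ωhi := fun t ht v hv u hu =>
    hωb t v u (by rw [abs_of_pos ht.1]; linarith [ht.2])
      (by rw [abs_of_pos hv.1]; linarith [hv.2]) (by rw [abs_of_pos hu.1]; linarith [hu.2])
  have hωB4 : ∀ t ∈ Ioo (0 : ℝ) (4 * δt), ∀ v ∈ Ioo (0 : ℝ) (4 * δ), ∀ u ∈ Ioo (0 : ℝ) (4 * ε),
      ωlo ≤ ωa t v u ∧ ωa t v u ≤ ωhi := fun t ht v hv u hu =>
    hωB t ht v ⟨hv.1, by linarith [hv.2]⟩ u ⟨hu.1, by linarith [hu.2]⟩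
  -- monotonicity and logarithmic costs of the weight
  have hmonoW := wt3_mono Dt 0 0 hωlo hωB4 KΛ (Λ' := Λ') (hΛmono δt δ ε h4δt h4δ h4ε)
  set K : ℝ≥0∞ := ENNReal.ofReal (4 ^ Dt * 4 ^ 0 * 4 ^ 0 * (ωhi / ωlo)) * KΛ with hK
  have hKne : K ≠ ∞ := ENNReal.mul_ne_top ENNReal.ofReal_ne_top hKΛ
  have hvlogW := wt3_vlog Dt 0 0 hωlo hωB rfl Kn CΛ (Λ' := Λ') (hΛv δt (4 * δ) (4 * ε) hδtδ₀ h4δ h4ε)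
  have hulogW := wt3_ulog Dt 0 0 hωlo hωB rfl Kn CΛ (Λ' := Λ') (hΛu δt (4 * δ) (4 * ε) hδtδ₀ h4δ h4ε)
  set C : ℝ≥0∞ := ENNReal.ofReal (ωhi / ωlo) * CΛ with hC
  have hCne : C ≠ ∞ := ENNReal.mul_ne_top ENNReal.ofReal_ne_top hCΛ
  -- the conversion identity on the big box
  have hden : ∀ t ∈ Ioo (0 : ℝ) (4 * δt), ∀ v ∈ Ioo (0 : ℝ) (4 * δ), ∀ u ∈ Ioo (0 : ℝ) (4 * ε),
      |common κ μ e n l₁ l₂ l₀ (npt z₁ d Q S t v u)| = t ^ Dt * ωa t v u ∧ 0 < t ^ Dt * ωa t v u := by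
    intro t ht v hv u hu
    refine ⟨hcommon t v u ht.1.le hv.1.le hu.1.le, mul_pos (pow_pos ht.1 _) ?_⟩
    exact hωlo.trans_le (hωB4 t ht v hv u hu).1
  have hWeq : ∀ t v u, W t v u = ENNReal.ofReal (t ^ 2 * v / (t ^ Dt * ωa t v u)) * Λ' t v u :=
    fun t v u => wt3_zero_zero Dt ωa Λ' t v u
  have hconvR : ∀ t ∈ Ioo (0 : ℝ) (4 * δt), ∀ v ∈ Ioo (0 : ℝ) (4 * δ), ∀ u ∈ Ioo (0 : ℝ) (4 * ε),
      ENNReal.ofReal (t ^ 2 * v) * (ENNReal.ofReal |R (npt z₁ d Q S t v u)| * mm (npt z₁ d Q S t v u)) =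
        ENNReal.ofReal |pev (fun a' : Fin (3 * D + 1) => Fnum l₁ l₂ (crow c a') (evec d Q S v u)) t| *
          W t v u := by
    intro t ht v hv u hu
    have hnum : (∑ i ∈ Finset.range N, MvPolynomial.eval (pr2 (npt z₁ d Q S t v u)) (q i) *
        lam3 l₁ l₂ l₀ (npt z₁ d Q S t v u) ^ i) =
        pev (fun a' : Fin (3 * D + 1) => Fnum l₁ l₂ (crow c a') (evec d Q S v u)) t := by
      rw [npt_eq, hF, Fnum_smul_pev]
    rw [hR, hWeq]
    exact piece_eq_wt (by have := ht.1.le; have := hv.1.le; positivity) (by rw [hnum])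
      (hden t ht v hv u hu).1 (hden t ht v hv u hu).2 _
  -- the finiteness hypothesis in blown-up coordinates
  have hfin := hfin_of_inside3 z₁ d Q S hm hRm hfinY hdet hin4
  rw [setLIntegral_congr_fun measurableSet_Ioo fun t ht => setLIntegral_congr_fun measurableSet_Ioo
    fun v hv => setLIntegral_congr_fun measurableSet_Ioo fun u hu => hconvR t ht v hv u hu] at hfin
  -- the ray theorem
  have hΦm : ∀ a' : Fin (3 * D + 1), Measurable fun p : ℝ × ℝ =>
      Fnum l₁ l₂ (crow c a') (evec d Q S p.1 p.2) := fun a' =>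
    ((continuous_Fnum l₁ l₂ (crow c a')).comp (continuous_evec d Q S)).measurable
  have hle' : ∀ v ∈ Icc (2 * δ) (4 * δ), ∀ u ∈ Icc (2 * ε) (4 * ε),
      h ≤ |Fnum l₁ l₂ (crow c a₀) (evec d Q S v u)| := fun v hv u hu => by
    rw [← evalEval_PP]; exact hle v hv u hu
  have hray := ray_order3 W hWm (fun a' v u => Fnum l₁ l₂ (crow c a') (evec d Q S v u)) hΦm K hKne
    Kn C hCne hδ.1 hε.1
    (fun v hv u hu t t' ht htt' ht't ht' => hmonoW t v u t' v u ht htt' ht't ht' hv.1 le_rfl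
      (by linarith [hv.1]) hv.2 hu.1 le_rfl (by linarith [hu.1]) hu.2)
    (fun t ht u hu v v' hv hvv' hv' => hvlogW t ht.1 ht.2 u hu.1 hu.2 v v' hv hvv' hv')
    (fun t ht v hv u u' hu huu' hu' => hulogW t ht.1 ht.2 v (by linarith [hv.1]) hv.2 u u' hu huu' hu')
    ⟨a₀, ha₀⟩ hh hle' hfin
  -- the pieces
  intro i hiR
  have hiN : i < N := Finset.mem_range.1 hiR
  have hconv : ∀ t ∈ Ioo (0 : ℝ) δt, ∀ v ∈ Ioo (0 : ℝ) δ, ∀ u ∈ Ioo (0 : ℝ) ε,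
      ENNReal.ofReal (t ^ 2 * v) * (ENNReal.ofReal |Ri i (npt z₁ d Q S t v u)| * mm (npt z₁ d Q S t v u)) =
        ENNReal.ofReal |Fpc l₁ l₂ c ⟨i, lt_of_lt_of_le hiN hND⟩ (t • evec d Q S v u)| * W t v u := by
    intro t ht v hv u hu
    have ht4 := Ioo_four hδt.1 ht
    have hv4 := Ioo_four hδ.1 hv
    have hu4 := Ioo_four hε.1 hu
    have hnum : MvPolynomial.eval (pr2 (npt z₁ d Q S t v u)) (q i) * lam3 l₁ l₂ l₀ (npt z₁ d Q S t v u) ^ i =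
        Fpc l₁ l₂ c ⟨i, lt_of_lt_of_le hiN hND⟩ (t • evec d Q S v u) := by
      rw [npt_eq, hFi i hiN]
    rw [hRi i hiN, hWeq]
    exact piece_eq_wt (by have := ht.1.le; have := hv.1.le; positivity) (by rw [hnum])
      (hden t ht4 v hv4 u hu4).1 (hden t ht4 v hv4 u hu4).2 _
  rw [setLIntegral_congr_fun measurableSet_Ioo fun t ht => setLIntegral_congr_fun measurableSet_Ioo
    fun v hv => setLIntegral_congr_fun measurableSet_Ioo fun u hu => hconv t ht v hv u hu]
  refine piece_order_lt_top W measurableSet_Ioo measurableSet_Ioo measurableSet_Ioo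
    (fun t v u => Fpc l₁ l₂ c ⟨i, lt_of_lt_of_le hiN hND⟩ (t • evec d Q S v u)) a₀
    (by positivity : (0 : ℝ) ≤ (3 * D + 1) * B) (fun t ht v hv u hu => ?_) ?_
  · exact abs_Fpc_smul_le l₁ l₂ c hlow _ _ (fun a' => hB a' _ v ⟨hv.1.le, by linarith [hv.2]⟩ u
      ⟨hu.1.le, by linarith [hu.2, hη₁1]⟩) ht.1.le (by linarith [ht.2])
  · refine lt_of_le_of_lt (lintegral_mono fun t => ?_) hray
    exact (lintegral_mono_set (Ioo_subset_Ioo le_rfl (by linarith))).trans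
      (lintegral_mono fun v => lintegral_mono_set (Ioo_subset_Ioo le_rfl (by linarith)))

end SepHHK

/-- **The sector theorem of type (I) on a nested thin sector** (registered part of
`stub_separateHigh`, base dimension `3` with fibres; consequence of `SepHHK.sector_typeI`): at a
base point `z₁` with graded numerator data `c ≠ 0`, for a frame `d, Q, S` along which the common
denominator carries the power `t^{Dt}` and a two-sided bounded measurable regular factor only, the
density of the Taylor pieces against the fibre mass has finite integral over the nested sector for
all small scales. -/
theorem separateThreeHHK_secI (k mL m'' : ℕ) (φ : Fin m'' → (Fin 3 → ℝ) × ℝ) (lo hi : Fin k → Fin k ⊕ ((Fin 3 → ℚ) × ℚ)) (a : Fin k → Option ((Fin 3 → ℚ) × ℚ)) (κ : Fin mL → Fin 2 → ℝ) (μ : Fin mL → ℝ) (e : Fin mL → ℕ) (n : ℕ) (l₁ l₂ l₀ : ℝ) (N : ℕ) (q : ℕ → MvPolynomial (Fin 2) ℝ) (R : (Fin 3 → ℝ) → ℝ) (Ri : ℕ → (Fin 3 → ℝ) → ℝ) (z₁ : Fin 3 → ℝ) (hR : ∀ x, R x = (∑ i ∈ Finset.range N, MvPolynomial.eval (SepHHK.pr2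 x) (q i) * SepHHK.lam3 l₁ l₂ l₀ x ^ i) / SepHHK.common κ μ e n l₁ l₂ l₀ x) (hRi : ∀ i < N, ∀ x, Ri i x = MvPolynomial.eval (SepHHK.pr2 x) (q i) * SepHHK.lam3 l₁ l₂ l₀ x ^ i / SepHHK.common κ μ e n l₁ l₂ l₀ x) (hRm : Measurable R) (hRim : ∀ i, Measurable (Ri i)) (hfinY : MeasureTheory.lintegral (MeasureTheory.volume.restrict {x | ∀ j, 0 < SepHHK.rav x (φ j)}) (fun x => ENNReal.ofReal |R x| * SepTwo.lmass lo hi a (SepTwo.av x)) < ⊤) (D : ℕ) (hND : N ≤ D + 1) (c : Fin (D + 1) → Fin (D + 1) → Fin (D + 1) → ℝ) (hc : c ≠ 0) (hF : ∀ ξ : Fin 3 → ℝ, (∑ i ∈ Finset.range N, MvPolynomial.eval (SepHHK.pr2 (z₁ + ξ)) (q i) * SepHHK.lam3 l₁ l₂ l₀ (z₁ + ξ) ^ i) = SepHHK.Fnum l₁ l₂ c ξ) (hFi : ∀ (i : ℕ) (hi : i < N) (ξ : Fin 3 → ℝ), MvPolynomial.eval (SepHHK.pr2 (z₁ + ξ))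 (q i) * SepHHK.lam3 l₁ l₂ l₀ (z₁ + ξ) ^ i = SepHHK.Fpc l₁ l₂ c ⟨i, lt_of_lt_of_le hi hND⟩ ξ) (d Q S : Fin 3 → ℝ) (hdet : SepHHK.det3 d Q S ≠ 0) (Dt : ℕ) (ω : ℝ → ℝ → ℝ → ℝ) (hωm : Measurable fun p : ℝ × ℝ × ℝ => ω p.1 p.2.1 p.2.2) (hcommon : ∀ t v u : ℝ, 0 ≤ t → 0 ≤ v → 0 ≤ u → |SepHHK.common κ μ e n l₁ l₂ l₀ (SepHHK.npt z₁ d Q S t v u)| = t ^ Dt * |ω t v u|) (ωlo ωhi ρ : ℝ) (hωlo : 0 < ωlo) (hρ : 0 < ρ) (hωb : ∀ t v u : ℝ, |t| < ρ → |v| < ρ → |u| < ρ → ωlo ≤ |ω t v u| ∧ |ω t v u| ≤ ωhi) : ∀ᶠ δt in nhdsWithin (0 : ℝ) (Set.Ioi 0), ∀ᶠ δ in nhdsWithin (0 : ℝ) (Set.Ioi 0), ∀ᶠ ε in nhdsWithin (0 : ℝ) (Set.Ioi 0), MeasureTheory.lintegral (MeasureTheory.volume.restrict (SepHHK.nsector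 z₁ d Q S δt δ (Set.Ico 0 ε))) (fun z => {x : Fin 3 → ℝ | ∀ j, 0 < SepHHK.rav x (φ j)}.indicator (fun x => (∑ i ∈ Finset.range N, ENNReal.ofReal |Ri i x|) * SepTwo.lmass lo hi a (SepTwo.av x)) z) < ⊤ := by
  exact SepHHK.sector_typeI φ lo hi a κ μ e n l₁ l₂ l₀ N q R Ri z₁ hR hRi hRm hRim hfinY hND c hc hF hFi d Q S hdet Dt ω hωm hcommon hωlo hρ hωb

end Summit.KontsevichZagierPeriods.ArrangementNormalForm.JanusBands
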